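import Summits.KontsevichZagierPeriods.KontsevichZagierPeriods.Theorems.RootDecompRelativeModAbsoluteCylLogSplitP18

/-! # `RootDecompRelativeModAbsoluteCylLogSplitP19` — part 19/25 of the mechanical ≤330-line split of `CylLogSplit.lean`
(split by the decomp-kz census seat for landing; mathematics unchanged; part 19 continues part 18). -/

noncomputable section
open Set MeasureTheory Filter Topology
open scoped BigOperators
open Literature.NumberTheory.Transcendental Literature.ModelTheory.ExponentialFields

namespace Summit.KontsevichZagierPeriods.RootDecompRelativeModAbsolute.Rung30571

namespace RegularisedLogLayer

namespace CylLog
variable {b : ℕ}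

namespace MixedInstance
open DegenerateInstance

end MixedInstance

/-! ### §3t FOLDING LEMMAS for glue D1/D8 (any base dimension): a `θ`-constant integrand and a `κ ≡ 0` monomial
fold to the base by Newton–Leibniz with a POLYNOMIAL primitive — PROVED

After D1 the cylinder terms with `κᵢ ≡ 0` on a base cell read `cᵢ(x) θ^{Mᵢ}` and the constant term reads `a₀(x)`; both are
closed-band representations over the cell (open→closed, `exists_closedBand_of_openCell'`) and fold to `[G, cᵢ/(Mᵢ+1)]`,
`[G, a₀]` (used as r11 of §3l/§3s; here in general form). -/

/-- `[band G 0 1, a(x)] ≡ [G, a]` (Newton–Leibniz, `F = θ·a(x)`). -/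
theorem exists_base_of_thetaConst {b : ℕ} {G : Set (Fin b → ℝ)} (hG : IsSemialgebraic ℚ G)
    {a : (Fin b → ℝ) → ℝ} (ha : IsSemialgebraicFunOn ℚ G a) (hai : IntegrableOn a G)
    (A : KZ.IntegralRep (b + 1)) (hAd : A.domain = KZlog.band G (fun _ => 0) (fun _ => 1))
    (hAi : A.integrand = fun z => a (Fin.init z)) :
    ∃ B : KZ.IntegralRep b, B.domain = G ∧ B.integrand = a ∧ KZ.of A - KZ.of B ∈ KZ.relations := by
  have h0sa : IsSemialgebraicFunOn ℚ G (fun _ => (0:ℝ)) :=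
    (isSemialgebraicFunOn_ratCast hG 0).congr fun _ _ => by simp
  have h1sa : IsSemialgebraicFunOn ℚ G (fun _ => (1:ℝ)) :=
    (isSemialgebraicFunOn_ratCast hG 1).congr fun _ _ => by simp
  have hband : IsSemialgebraic ℚ (KZlog.band G (fun _ => (0:ℝ)) (fun _ => 1)) :=
    KZlog.isSemialgebraic_band h0sa h1sa
  have hbandG : KZlog.band G (fun _ => (0:ℝ)) (fun _ => 1) ⊆ {z | (Fin.init z : Fin b → ℝ) ∈ G} :=
    fun z hz => hz.1
  let B : KZ.IntegralRep b :=
    { domain := G, integrand := a, isSemialgebraic_domain := hG, isSemialgebraicFunOn_integrand := ha,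
      integrableOn := hai }
  have hFsa : IsSemialgebraicFunOn ℚ A.domain (fun z => z (Fin.last b) * a (Fin.init z)) := by
    rw [hAd]
    exact IsSemialgebraicFunOn.mul_holds (isSemialgebraicFunOn_apply hband (Fin.last b))
      (ha.comp_init.mono hbandG hband)
  refine ⟨B, rfl, rfl, KZ.newtonLeibnizRel_subset_relations ⟨b, A, B, fun _ => 0, fun _ => 1,
    fun z => z (Fin.last b) * a (Fin.init z), hFsa, h0sa, h1sa, fun _ _ => zero_le_one,
    ?_, ?_, ?_, ?_, rfl⟩⟩
  · rw [hAd]; rfl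
  · intro x _
    simp only [Fin.snoc_last, Fin.init_snoc]
    fun_prop
  · intro x _ t _
    simp only [hAi, Fin.snoc_last, Fin.init_snoc]
    simpa using (hasDerivAt_id' t).mul_const (a x)
  · intro x _
    show a x = _
    simp only [Fin.snoc_last, Fin.init_snoc]
    ring

/-- `[band G 0 1, c(x) θ^M] ≡ [G, c/(M+1)]` (Newton–Leibniz, `F = c(x) θ^{M+1}/(M+1)`). -/
theorem exists_base_of_monomial {b M : ℕ} {G : Set (Fin b → ℝ)} (hG : IsSemialgebraic ℚ G)
    {c : (Fin b → ℝ) → ℝ} (hc : IsSemialgebraicFunOn ℚ G c) (hci : IntegrableOn c G)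
    (A : KZ.IntegralRep (b + 1)) (hAd : A.domain = KZlog.band G (fun _ => 0) (fun _ => 1))
    (hAi : A.integrand = fun z => c (Fin.init z) * z (Fin.last b) ^ M) :
    ∃ B : KZ.IntegralRep b, B.domain = G ∧ (B.integrand = fun x => c x / ((M : ℝ) + 1)) ∧
      KZ.of A - KZ.of B ∈ KZ.relations := by
  have h0sa : IsSemialgebraicFunOn ℚ G (fun _ => (0:ℝ)) :=
    (isSemialgebraicFunOn_ratCast hG 0).congr fun _ _ => by simp
  have h1sa : IsSemialgebraicFunOn ℚ G (fun _ => (1:ℝ)) :=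
    (isSemialgebraicFunOn_ratCast hG 1).congr fun _ _ => by simp
  have hband : IsSemialgebraic ℚ (KZlog.band G (fun _ => (0:ℝ)) (fun _ => 1)) :=
    KZlog.isSemialgebraic_band h0sa h1sa
  have hbandG : KZlog.band G (fun _ => (0:ℝ)) (fun _ => 1) ⊆ {z | (Fin.init z : Fin b → ℝ) ∈ G} :=
    fun z hz => hz.1
  have hM : ((M : ℝ) + 1) ≠ 0 := by positivity
  have hBsa : IsSemialgebraicFunOn ℚ G (fun x => c x / ((M : ℝ) + 1)) := by
    have hk : IsSemialgebraicFunOn ℚ G (fun _ => ((M : ℝ) + 1)⁻¹) :=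
      (isSemialgebraicFunOn_ratCast hG (((M : ℚ) + 1)⁻¹)).congr fun z _ => by push_cast; ring
    exact (IsSemialgebraicFunOn.mul_holds hc hk).congr fun z _ => by simp [div_eq_mul_inv]
  let B : KZ.IntegralRep b :=
    { domain := G, integrand := fun x => c x / ((M : ℝ) + 1), isSemialgebraic_domain := hG,
      isSemialgebraicFunOn_integrand := hBsa, integrableOn := hci.div_const _ }
  set F : (Fin (b + 1) → ℝ) → ℝ := fun z =>
    c (Fin.init z) * (z (Fin.last b) ^ (M + 1) / ((M : ℝ) + 1)) with hF
  have hFsa : IsSemialgebraicFunOn ℚ A.domain F := by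
    rw [hAd]
    have hk : IsSemialgebraicFunOn ℚ (KZlog.band G (fun _ => (0:ℝ)) (fun _ => 1))
        (fun _ => ((M : ℝ) + 1)⁻¹) :=
      (isSemialgebraicFunOn_ratCast hband (((M : ℚ) + 1)⁻¹)).congr fun z _ => by push_cast; ring
    exact (IsSemialgebraicFunOn.mul_holds (hc.comp_init.mono hbandG hband)
      (IsSemialgebraicFunOn.mul_holds (isSemialgebraicFunOn_pow' hband
        (isSemialgebraicFunOn_apply hband (Fin.last b)) (M + 1)) hk)).congr
      fun z _ => by simp [hF, div_eq_mul_inv]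
  refine ⟨B, rfl, rfl, KZ.newtonLeibnizRel_subset_relations ⟨b, A, B, fun _ => 0, fun _ => 1, F, hFsa,
    h0sa, h1sa, fun _ _ => zero_le_one, ?_, ?_, ?_, ?_, rfl⟩⟩
  · rw [hAd]; rfl
  · intro x _
    have hcont : Continuous fun t : ℝ => F (Fin.snoc x t) := by
      simp only [hF, Fin.init_snoc, Fin.snoc_last]
      fun_prop
    exact hcont.continuousOn
  · intro x _ t _
    have h1 : HasDerivAt (fun s : ℝ => s ^ (M + 1) / ((M : ℝ) + 1))
        (((M + 1 : ℕ) : ℝ) * t ^ M / ((M : ℝ) + 1)) t := (hasDerivAt_pow (M + 1) t).div_const _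
    have h2 := h1.const_mul (c x)
    have hval : c x * ((((M + 1 : ℕ) : ℝ)) * t ^ M / ((M : ℝ) + 1)) = c x * t ^ M := by
      rw [Nat.cast_add_one, mul_div_cancel_left₀ _ hM]
    rw [hval] at h2
    simp only [hAi, hF, Fin.init_snoc, Fin.snoc_last]
    exact h2
  · intro x _
    show c x / ((M : ℝ) + 1) = _
    simp only [hF, Fin.init_snoc, Fin.snoc_last]
    rw [one_pow, zero_pow (Nat.succ_ne_zero M)]
    ring

/-! ### §3u RESTRICTING A BAND TO A FINITE PARTITION OF THE BASE up to a null set (glue D3: the plug for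
`LogStructure`'s cells `C : Fin N → Set _`, pairwise disjoint, open, `volume (U ∖ ⋃ C c) = 0`) — PROVED

`[band G p q, f] ≡ Σ_c [band (C c) p q, f]` (rule 1a iterated, `KZ.exists_split_band`; the band over the null remainder is
null, `KZ.volume_setOf_init_mem_eq_zero`). -/

/-- Auxiliary step `iUnion_fin_succ`. [bookkeeping] -/
theorem iUnion_fin_succ {α : Type*} {N : ℕ} (C : Fin (N + 1) → Set α) :
    (⋃ c, C c) = C 0 ∪ ⋃ c : Fin N, C c.succ := by
  ext x
  simp only [mem_iUnion, mem_union, Fin.exists_fin_succ]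

/-- Auxiliary step `exists_restrict_bands`. [bookkeeping] -/
theorem exists_restrict_bands {b : ℕ} {p q : (Fin b → ℝ) → ℝ} :
    ∀ (N : ℕ) (C : Fin N → Set (Fin b → ℝ)), (∀ c, IsSemialgebraic ℚ (C c)) →
      Pairwise (Function.onFun Disjoint C) →
      IsSemialgebraicFunOn ℚ (⋃ c, C c) p → IsSemialgebraicFunOn ℚ (⋃ c, C c) q →
      ∀ (R : KZ.IntegralRep (b + 1)), R.domain = KZlog.band (⋃ c, C c) p q →
      ∃ Rc : Fin N → KZ.IntegralRep (b + 1), (∀ c, (Rc c).domain = KZlog.band (C c) p q) ∧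
        (∀ c, (Rc c).integrand = R.integrand) ∧ KZ.of R - ∑ c, KZ.of (Rc c) ∈ KZ.relations
  | 0, C, _, _, _, _, R, hRd => by
    refine ⟨fun c => Fin.elim0 c, fun c => Fin.elim0 c, fun c => Fin.elim0 c, ?_⟩
    have hR0 : volume R.domain = 0 := by
      have h : R.domain = ∅ := by
        rw [hRd]
        ext z
        simp [KZlog.band]
      rw [h, measure_empty]
    simpa using KZ.of_mem_relations_of_volume_eq_zero R hR0
  | N + 1, C, hC, hdisj, hp, hq, R, hRd => by
    have hU := iUnion_fin_succ C
    have hs : IsSemialgebraic ℚ (C 0) := hC 0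
    have ht : IsSemialgebraic ℚ (⋃ c : Fin N, C c.succ) := by
      simpa using IsSemialgebraic.biUnion Finset.univ (fun c : Fin N => C c.succ) fun c _ => hC c.succ
    have hst : C 0 ∩ (⋃ c : Fin N, C c.succ) = ∅ := by
      ext x
      simp only [mem_inter_iff, mem_empty_iff_false, iff_false, not_and]
      intro h0 hxt
      obtain ⟨c, hc⟩ := mem_iUnion.mp hxt
      exact Set.disjoint_left.mp (hdisj (Fin.succ_ne_zero c).symm) h0 hc
    obtain ⟨Rs, Rt, hRsd, hRsi, hRtd, hRti, hrel⟩ := KZ.exists_split_band R hRd hU hst hs ht hp hq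
    have hdisj' : Pairwise (Function.onFun Disjoint fun c : Fin N => C c.succ) :=
      fun i j hij => hdisj ((Fin.succ_injective N).ne hij)
    have htU : (⋃ c : Fin N, C c.succ) ⊆ ⋃ c, C c := hU ▸ subset_union_right
    obtain ⟨Rc', hd', hi', hrel'⟩ := exists_restrict_bands N (fun c => C c.succ) (fun c => hC c.succ)
      hdisj' (hp.mono htU ht) (hq.mono htU ht) Rt hRtd
    refine ⟨Fin.cons Rs Rc', fun c => ?_, fun c => ?_, ?_⟩
    · refine Fin.cases ?_ (fun i => ?_) c
      · simpa using hRsd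
      · simpa using hd' i
    · refine Fin.cases ?_ (fun i => ?_) c
      · simpa using hRsi
      · simpa using (hi' i).trans hRti
    · rw [Fin.sum_univ_succ]
      simp only [Fin.cons_zero, Fin.cons_succ]
      have e : KZ.of R - (KZ.of Rs + ∑ i : Fin N, KZ.of (Rc' i)) =
          (KZ.of R - KZ.of Rs - KZ.of Rt) + (KZ.of Rt - ∑ i : Fin N, KZ.of (Rc' i)) := by abel
      rw [e]
      exact add_mem hrel hrel'

/-- **Band over `G` ≡ the bands over the cells of a finite partition of `G` up to a null set** (the shape of
`LogStructure`'s output). -/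
theorem exists_restrict_bands_ae {b N : ℕ} {G : Set (Fin b → ℝ)} {p q : (Fin b → ℝ) → ℝ}
    (hG : IsSemialgebraic ℚ G) (hp : IsSemialgebraicFunOn ℚ G p) (hq : IsSemialgebraicFunOn ℚ G q)
    (C : Fin N → Set (Fin b → ℝ)) (hC : ∀ c, IsSemialgebraic ℚ (C c)) (hCG : ∀ c, C c ⊆ G)
    (hdisj : Pairwise (Function.onFun Disjoint C)) (hnull : volume (G \ ⋃ c, C c) = 0)
    (R : KZ.IntegralRep (b + 1)) (hRd : R.domain = KZlog.band G p q) :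
    ∃ Rc : Fin N → KZ.IntegralRep (b + 1), (∀ c, (Rc c).domain = KZlog.band (C c) p q) ∧
      (∀ c, (Rc c).integrand = R.integrand) ∧ KZ.of R - ∑ c, KZ.of (Rc c) ∈ KZ.relations := by
  have hs : IsSemialgebraic ℚ (⋃ c, C c) := by
    simpa using IsSemialgebraic.biUnion Finset.univ C fun c _ => hC c
  have hsG : (⋃ c, C c) ⊆ G := iUnion_subset hCG
  have ht : IsSemialgebraic ℚ (G \ ⋃ c, C c) := hG.diff hs
  have hU : G = (⋃ c, C c) ∪ (G \ ⋃ c, C c) := (union_sdiff_cancel hsG).symm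
  have hst : (⋃ c, C c) ∩ (G \ ⋃ c, C c) = ∅ := inter_sdiff_self _ _
  obtain ⟨Rs, Rt, hRsd, hRsi, hRtd, hRti, hrel⟩ := KZ.exists_split_band R hRd hU hst hs ht hp hq
  have hRt : KZ.of Rt ∈ KZ.relations := by
    refine KZ.of_mem_relations_of_volume_eq_zero Rt ?_
    rw [hRtd]
    exact measure_mono_null (fun z hz => hz.1) (KZ.volume_setOf_init_mem_eq_zero hnull)
  obtain ⟨Rc, hd, hi, hrel'⟩ := exists_restrict_bands N C hC hdisj (hp.mono hsG hs) (hq.mono hsG hs) Rs hRsd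
  refine ⟨Rc, hd, fun c => (hi c).trans hRsi, ?_⟩
  have e : KZ.of R - ∑ c, KZ.of (Rc c) =
      (KZ.of R - KZ.of Rs - KZ.of Rt) + KZ.of Rt + (KZ.of Rs - ∑ c, KZ.of (Rc c)) := by abel
  rw [e]
  exact add_mem (add_mem hrel hRt) hrel'

/-! ### §3v D1 REFINEMENTS (any base dimension): restricting a representation to a finite partition of its domain,
and the ORIENTATION PARTITION `G = {L>1} ⊔ {L<1} ⊔ {L=1}° ⊔ (null)` of an open base by a continuous semialgebraic `L`
(discharges the hypothesis `hL` of `regCells_mem_relations_of_relation` cell by cell) — PROVED -/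

/-- Auxiliary step `interior_diff_interior_eq_empty`. [bookkeeping] -/
theorem interior_diff_interior_eq_empty {α : Type*} [TopologicalSpace α] (s : Set α) :
    interior (s \ interior s) = ∅ := by
  refine Set.subset_eq_empty (fun x hx => ?_) rfl
  have h1 : x ∈ interior s := interior_mono sdiff_subset hx
  have h2 : x ∈ s \ interior s := interior_subset hx
  exact (h2.2 h1).elim

/-- `[⋃ C c, f] ≡ Σ_c [C c, f]` for a finite disjoint semialgebraic partition (rule 1a iterated). -/
theorem exists_restrict_parts {n : ℕ} :
    ∀ (N : ℕ) (C : Fin N → Set (Fin n → ℝ)), (∀ c, IsSemialgebraic ℚ (C c)) →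
      Pairwise (Function.onFun Disjoint C) →
      ∀ (R : KZ.IntegralRep n), R.domain = ⋃ c, C c →
      ∃ Rc : Fin N → KZ.IntegralRep n, (∀ c, (Rc c).domain = C c) ∧
        (∀ c, (Rc c).integrand = R.integrand) ∧ KZ.of R - ∑ c, KZ.of (Rc c) ∈ KZ.relations
  | 0, C, _, _, R, hRd => by
    refine ⟨fun c => Fin.elim0 c, fun c => Fin.elim0 c, fun c => Fin.elim0 c, ?_⟩
    have hR0 : volume R.domain = 0 := by
      rw [hRd]
      simp
    simpa using KZ.of_mem_relations_of_volume_eq_zero R hR0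
  | N + 1, C, hC, hdisj, R, hRd => by
    have hU := iUnion_fin_succ C
    have hs : IsSemialgebraic ℚ (C 0) := hC 0
    have ht : IsSemialgebraic ℚ (⋃ c : Fin N, C c.succ) := by
      simpa using IsSemialgebraic.biUnion Finset.univ (fun c : Fin N => C c.succ) fun c _ => hC c.succ
    have hst : C 0 ∩ (⋃ c : Fin N, C c.succ) = ∅ := by
      ext x
      simp only [mem_inter_iff, mem_empty_iff_false, iff_false, not_and]
      intro h0 hxt
      obtain ⟨c, hc⟩ := mem_iUnion.mp hxt
      exact Set.disjoint_left.mp (hdisj (Fin.succ_ne_zero c).symm) h0 hc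
    have hsR : C 0 ⊆ R.domain := by
      rw [hRd, hU]; exact subset_union_left
    have htR : (⋃ c : Fin N, C c.succ) ⊆ R.domain := by
      rw [hRd, hU]; exact subset_union_right
    have hrel : KZ.of R - KZ.of (R.restrict _ hs hsR) - KZ.of (R.restrict _ ht htR) ∈ KZ.relations := by
      refine KZ.domainAddRel_subset_relations ⟨n, R, R.restrict _ hs hsR, R.restrict _ ht htR, ?_, ?_,
        fun _ _ => rfl, fun _ _ => rfl, rfl⟩
      · rw [KZ.IntegralRep.domain_restrict, KZ.IntegralRep.domain_restrict, ← hU]; exact hRd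
      · rw [KZ.IntegralRep.domain_restrict, KZ.IntegralRep.domain_restrict, hst, measure_empty]
    have hdisj' : Pairwise (Function.onFun Disjoint fun c : Fin N => C c.succ) :=
      fun i j hij => hdisj ((Fin.succ_injective N).ne hij)
    obtain ⟨Rc', hd', hi', hrel'⟩ := exists_restrict_parts N (fun c => C c.succ) (fun c => hC c.succ)
      hdisj' (R.restrict _ ht htR) rfl
    refine ⟨Fin.cons (R.restrict _ hs hsR) Rc', fun c => ?_, fun c => ?_, ?_⟩
    · refine Fin.cases ?_ (fun i => ?_) c
      · simp
      · simpa using hd' i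
    · refine Fin.cases ?_ (fun i => ?_) c
      · simp
      · simpa using hi' i
    · rw [Fin.sum_univ_succ]
      simp only [Fin.cons_zero, Fin.cons_succ]
      have e : KZ.of R - (KZ.of (R.restrict _ hs hsR) + ∑ i : Fin N, KZ.of (Rc' i)) =
          (KZ.of R - KZ.of (R.restrict _ hs hsR) - KZ.of (R.restrict _ ht htR)) +
            (KZ.of (R.restrict _ ht htR) - ∑ i : Fin N, KZ.of (Rc' i)) := by abel
      rw [e]
      exact add_mem hrel hrel'

end CylLog
end RegularisedLogLayer
end Summit.KontsevichZagierPeriods.RootDecompRelativeModAbsolute.Rung30571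
end
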